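import Literature.MathematicalPhysics.QuantumFieldTheory.Balaban1983to89.B9WalkLettersOpsFacts
import Literature.MathematicalPhysics.QuantumFieldTheory.Balaban1983to89.B9WalkLettersOpsLocality
import Literature.MathematicalPhysics.QuantumFieldTheory.Balaban1983to89.B9Thm37TransposedCommutator

/-!
# `Balaban1983to89.B9WalkLettersOpsO` — W-a FILE C-3: THE rows-18 WALK-LETTER RECORD WITH A GENERIC CUBE LETTER `G′_□(U) := O □ U` (`opsWalkYO`), ITS PINS, AND ITS
# THREE STRUCTURAL LAWS — `StaticOK` (letter-free), `Identities₂` FROM THE TWO LOCAL-INVERSE LAWS OF (3.88) AT `O` (hypotheses), `LocalityDir` FROM THE LOCALITY OF `O`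
# ON A READING DOMAIN `near ⊇ □̃ + 1` (hypothesis) — so that the N06 certificate's cube-letter slot can be re-pinned by `rfl` to ANY letter for which Cor. 3.6 holds

T. Bałaban, *Propagators for lattice gauge theories in a background field*, Commun. Math. Phys. **99** (1985) 389–434 [`Balaban1985BackgroundPropagators`, "B9"];
[4] = T. Bałaban, *Propagators and renormalization transformations for lattice gauge theories. II*, Commun. Math. Phys. **96** (1984) 223–250 [`Balaban1984PropagatorsII`].

statement-level skeleton of published theorems with citation tags; proofs where landed; nothing here is a claim about the Yang–Mills mass gap

THE PRINT.  p. 408 l. 35 – p. 409 l. 5 *«… The operators constructed for this sequence, which we denote by G′_□(U), … satisfy all the inequalities of Theorems 3.1-3.3»*;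
(3.87) *«G′₀ = Σ_□ h_□G′_□h_□»*; (3.88) *«Δ′_aG′₀ = I − Σ_□ K(h_□)G′_□h_□»*; p. 410 l. 14–15 *«A propagator G′_□ depends on U restricted to Ω₀(□) ⊂ □̃⁵ and the operator K(h) is semi-local»*.

WHY THIS FILE (pub-ymgap, node N06 [B9], rows 18 of the stage-11 certificate; dag-n06-c LOCATED-26 ∕ LOCATED-28, node00-def-Y WORD-79 + KEY FINDING «the FILE C re-pin of
`opsWalkY.Gsq` should be GENERIC: `Gsq : cubes → SiteOpY` + displayed hloc ∕ hlocT»).  This lineage's record `B9WalkLettersOps.opsWalkY` pins the slot `Gsq U □` to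
node00-def-Y's □̃-COMPRESSED local inverse `GsqY` — a local inverse in the (3.88) sense but NOT print's `G′_□(U)`, for which alone Cor. 3.6 gives (3.42); the certificate
(edition 115) therefore displays rows 18's (3.42) tables at a letter that has none.  This file makes the slot GENERIC:
* §0 the two (3.88) clauses AT THE COORDINATE MODELS FOR ANY LETTER FAMILY `Gl` with the two local-inverse laws as HYPOTHESES — ★ `eq388_coords_of_loc`, ★ `eq388T_coords_of_locT`
  (this lineage's `eq388_coords ∕ eq388T_coords` with def-Y's `eq388_GsqY` replaced by the abstract layer `eq388_deltaPrimeAY` ∕ `eq388T_sum`);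
* §1 ★★★ `opsWalkYO x b B cfg parS bI O` — `opsWalkY` with `Gsq := fun U □ => GcoS … (O □) U` for a generic cube letter `O : cubes → SiteOpY 𝔸`, every other field VERBATIM
  (`opsWalkYO_GsqY : opsWalkYO … (fun □ => GsqY … parS (cubeDomY x □)) = opsWalkY …` by `rfl`); `dirOpsWalkYO ∕ dirLettersWalkYO`; ★ `agreeWalkYO near ∕ rdWalkYO near` — the
  walk reading with a generic agreement domain `near □` (print's `Ω₀(□) ⊂ □̃⁵`; `rdWalkYO (nearDomY x) = rdWalkY` by `rfl`); the `rfl` pins;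
* §2 the laws: ★★ `staticOK_opsWalkYO` (letter-free), ★★★ `identities₂_opsWalkYO` (the 19 letter-free clauses as in `identities₂_opsWalkY`, the two (3.88) clauses by §0 from
  `hloc ∕ hlocT` AT `O`), ★★★ `localityDir_opsWalkYO` (w.r.t. `rdWalkYO near`, from `nearDomY ⊆ near` and the locality hypothesis `hO` on `O`; `K(h_□)`'s semi-locality is
  proved: `KhY_apply_congr_of_reads`) (this lineage's letter satisfies `hO` at `near := nearDomY x` by def-Y's `GsqY_congr_of_agree`, cf. `B9WalkLettersOpsLocality.GsqY_congr_of_agreeWalkY`).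
CONSUMERS.  node00-def-Y's next exps record (E-letter at `opsWalkYO … O`); the certificate's rows-18 pins; dag-n06-c's T1∕T2∕T4; lit-balaban's (R)-design letter `locLetterY`.

HONEST SCOPE.  Definitions with bodies + bookkeeping over this lineage's and node00-def-Y's landed algebra; the two local-inverse laws and the locality of `O` are
HYPOTHESES of the laws (discharged per letter elsewhere: `GsqY` — def-Y's compressed-inverse lemmas; `GpCubeY` — `Node00/OpsYLocalInverseSeq`; `locLetterY` —
`B9Cor36GpCoverBinders.gpLoc_cover_binders`); nothing of [B9] asserted; no regime; count-neutral; N06 NOT discharged; nothing continuum ∕ OS ∕ mass gap ∕ Clay.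
Cell `pub-ymgap` (D-0062), node N06 [B9], rows 18, seat `pub-ymgap-dag-n06-d` (gen 23).  Net new unproved facts: 0.  NEW file.
-/

noncomputable section

namespace Literature.MathematicalPhysics.QuantumFieldTheory.Balaban1983to89.B9WalkLettersOpsO

open Node00
open Node00.OpsYLeibnizLetters (pKY cKY ptKY ctKY KhY_eq_grad_right KhY_eq_div_left)
open B6KLevelCensusIndexV1 (KIdx)
open B6Ineq2142KLevelV1 (β lvl)
open B6Cover236MultiLevelBlocks (cubes)
open B9Thm37Whole (Ops Sizes StaticOK)
open B9Thm37WholeDir (DirLetters37 Identities₂)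
open B9RWSums346SecondDiffGp (DirOps37)
open B9Cor38Whole (WalkReading)
open B9Cor38WholeDir (LocalityDir)
open B9Thm37KLetterDir (KopDir)
open B9Thm37Sum (mulOp)
open B9Thm37CubeCoverCommutators (cutMulY hTY KhY eq388_deltaPrimeAY sum_cutMulY_mul_self deltaPrimeAY_mul_cutMulY one_le_Mh_and_P)
open B9Thm37TransposedCommutator (eq388T_sum)
open B9Thm39ReadingCoords (cR39)
open B9Ineq349SiteComposite (cdSL cdsSL etaS_pos)
open B9PinMembersKLevelV1 (MemberY geo9Y)
open B9GeoNbrCountKLevelV1 (nbrM₀Y)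
open B9CoReadingCoords (coordOpK)
open B9CoReadingCoordsS (XSK blkSK sIK GcoS DcoS DscoS LcoS)
open B9WalkLettersCoordsS (SblkY hWalkY cubeDomY gsqcoS walkCntM₀Y walkCntY mem_cubeDomY_of_hTY_ne_zero)
open B9WalkLettersCoordsLeib (pcoS ptcoS plcoS ccoS ctcoS clcoS cdcoS cltcoS dacoS dirDcoS dirDscoS mulcoS coordAlgHom
  leibD_coords leibT_coords leibL_coords inv_coords)
open B9WalkLettersKernels
open B9WalkLettersKernelsDom
open B9WalkLettersKernelsRows (kernels_nonneg)
open B9WalkLettersOps (opsWalkY dirOpsWalkY dirLettersWalkY kappaWalkY nearDomY agreeWalkY rdWalkY)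
open B9WalkLettersOpsFacts (staticOK_opsWalkY mulOp_hWalkY_eq_mulcoS)
open B9WalkLettersOpsLocality (KhY_apply_congr_of_reads mem_nearDomY_of_fdiff mem_nearDomY_of_bdiff mem_cubeDomY_of_avg)
open Node00.OpsYLocalInverse (GsqY)
open B6RandomWalk (HasMajorant)
open B6RandomWalkHom (HasMajorantHom hasMajorantHom_iff hasMajorantHom_zero)
open B9Thm34Ext (toB6)
open B6Partition118KLevelTorus (sum_hT_sq)

/-! ## §0 The (3.88) clauses at the coordinate models, for any letter family with the two local-inverse laws -/

section Coords

variable {d ℓ : ℕ} {hd : 1 ≤ d + 1} {hL : Odd (ℓ + 1) ∧ 1 < ℓ + 1} {b₀ b₁ : ℝ}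
variable {𝔸 : Type} [NormedRing 𝔸] [NormedAlgebra ℂ 𝔸] [CompleteSpace 𝔸] [FiniteDimensional ℝ 𝔸] {κ : Type} [Fintype κ] [DecidableEq κ]
variable (i : KIdx d ℓ hd hL b₀ b₁) (b : Module.Basis κ ℝ 𝔸) (B : B9.Backgrounds) (cfg : B.Cfg → CfgY 𝔸 i) (parS : SiteParY 𝔸 i)

omit [DecidableEq κ] in
/-- ★ **`Identities₂.eq388` AT THE MODELS FOR ANY CUBE-LETTER FAMILY** ((3.88) «Δ′_aG′₀ = I − Σ_□K(h_□)G′_□h_□», `K(h) = Σ_μ P_μ∇_{U,μ} + C`): over any real family `h_c` with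
`Σ_c h_c² = 1` and any operators `Gl c` with the ROW local-inverse law `h_c·Δ′_a(U)·Gl c·h_c = h_c²` (HYPOTHESIS — for print's `G′_□` it is (3.88)'s «hence»),
`Δ′_a * Σ_c M_{h_c} (η²c_R·φ(Gl c)) M_{h_c} = 1 − Σ_c ((Σ_μ P_{c,μ} * ∇_{U,μ}) + C_c) * (η²c_R·φ(Gl c)) * M_{h_c}` on the carrier (`φ = coordAlgHom`).
[cite: Balaban1985BackgroundPropagators, (3.87)–(3.90) p.409] -/
theorem eq388_coords_of_loc (hc : cR39 b ≠ 0) (U₁ : B.Cfg) {ι : Type} [Fintype ι] (hf : ι → SiteY i → ℝ) (hsq : ∀ z, ∑ c, hf c z ^ 2 = 1)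
    (Gl : ι → Module.End ℂ (SiteY i → 𝔸))
    (hloc : ∀ c, cutMulY (hf c) * deltaPrimeAY i parS (cfg U₁) * Gl c * cutMulY (hf c) = cutMulY (hf c) * cutMulY (hf c)) :
    dacoS i b B cfg parS U₁ * (∑ c, mulcoS i b (hf c) * ((etaS i ^ 2 * cR39 b) • coordAlgHom i b (Gl c)) * mulcoS i b (hf c))
      = 1 - ∑ c, ((∑ μ, pcoS i b B cfg U₁ (hf c) μ * dirDcoS i b B cfg U₁ μ) + ccoS i b B cfg parS U₁ (hf c))
          * ((etaS i ^ 2 * cR39 b) • coordAlgHom i b (Gl c)) * mulcoS i b (hf c) := by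
  set s : ℝ := etaS i ^ 2 * cR39 b with hs
  have hs0 : s ≠ 0 := mul_ne_zero (pow_ne_zero 2 (etaS_pos i).ne') hc
  have hη : etaS i ≠ 0 := (etaS_pos i).ne'
  have eM : ∀ c, mulcoS i b (hf c) = coordAlgHom i b (cutMulY (hf c)) := fun c => rfl
  have eΔ : dacoS i b B cfg parS U₁ = s⁻¹ • coordAlgHom i b (deltaPrimeAY i parS (cfg U₁)) := rfl
  have eP : ∀ c μ, pcoS i b B cfg U₁ (hf c) μ * dirDcoS i b B cfg U₁ μ = s⁻¹ • coordAlgHom i b (pKY i (cfg U₁) (hf c) μ * cdSL i (cfg U₁) μ) := by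
    intro c μ
    have e1 : pcoS i b B cfg U₁ (hf c) μ = (etaS i * cR39 b)⁻¹ • coordAlgHom i b (pKY i (cfg U₁) (hf c) μ) := rfl
    have e2 : dirDcoS i b B cfg U₁ μ = (etaS i)⁻¹ • coordAlgHom i b (cdSL i (cfg U₁) μ) := rfl
    rw [e1, e2, smul_mul_smul_comm, ← map_mul]
    congr 1
    rw [hs]; field_simp
  have eC : ∀ c, ccoS i b B cfg parS U₁ (hf c) = s⁻¹ • coordAlgHom i b (cKY i parS (hf c) (cfg U₁)) := fun c => rfl
  have eK : ∀ c, (∑ μ, pcoS i b B cfg U₁ (hf c) μ * dirDcoS i b B cfg U₁ μ) + ccoS i b B cfg parS U₁ (hf c)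
      = s⁻¹ • coordAlgHom i b (KhY i parS (hf c) (cfg U₁)) := by
    intro c
    simp only [eP, eC, ← Finset.smul_sum, ← smul_add, ← map_sum, ← map_add, ← KhY_eq_grad_right]
  simp only [eM, eΔ, eK]
  have lhs : ∀ c, coordAlgHom i b (cutMulY (hf c)) * (s • coordAlgHom i b (Gl c)) * coordAlgHom i b (cutMulY (hf c))
      = s • coordAlgHom i b (cutMulY (hf c) * Gl c * cutMulY (hf c)) := by
    intro c; rw [mul_smul_comm, smul_mul_assoc, map_mul, map_mul]
  simp only [lhs, ← Finset.smul_sum, ← map_sum, smul_mul_smul_comm, inv_mul_cancel₀ hs0, one_smul, ← map_mul,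
    eq388_deltaPrimeAY i parS (cfg U₁) hf hsq Gl hloc, map_sub, map_one]

omit [DecidableEq κ] in
/-- ★ **`Identities₂.eq388T` AT THE MODELS FOR ANY CUBE-LETTER FAMILY** ((3.88) transposed «G′₀Δ′_a = I − Σ_□ h_□G′_□(∇*_UPᵗ_□ + Cᵗ_□)»): same data with the COLUMN
local-inverse law `h_c·Gl c·Δ′_a(U)·h_c = h_c²` (HYPOTHESIS),
`(Σ_c M_{h_c} (η²c_R·φ(Gl c)) M_{h_c}) * Δ′_a = 1 − Σ_c M_{h_c} (η²c_R·φ(Gl c)) ((Σ_μ ∇*_{U,μ} * Pᵗ_{c,μ}) + Cᵗ_c)` on the carrier.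
[cite: Balaban1985BackgroundPropagators, (3.87)–(3.90) p.409, (3.8) p.392] -/
theorem eq388T_coords_of_locT (hc : cR39 b ≠ 0) (U₁ : B.Cfg) {ι : Type} [Fintype ι] (hf : ι → SiteY i → ℝ) (hsq : ∀ z, ∑ c, hf c z ^ 2 = 1)
    (Gl : ι → Module.End ℂ (SiteY i → 𝔸))
    (hlocT : ∀ c, cutMulY (hf c) * Gl c * deltaPrimeAY i parS (cfg U₁) * cutMulY (hf c) = cutMulY (hf c) * cutMulY (hf c)) :
    (∑ c, mulcoS i b (hf c) * ((etaS i ^ 2 * cR39 b) • coordAlgHom i b (Gl c)) * mulcoS i b (hf c)) * dacoS i b B cfg parS U₁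
      = 1 - ∑ c, mulcoS i b (hf c) * ((etaS i ^ 2 * cR39 b) • coordAlgHom i b (Gl c))
          * ((∑ μ, dirDscoS i b B cfg U₁ μ * ptcoS i b B cfg U₁ (hf c) μ) + ctcoS i b B cfg parS U₁ (hf c)) := by
  set s : ℝ := etaS i ^ 2 * cR39 b with hs
  have hs0 : s ≠ 0 := mul_ne_zero (pow_ne_zero 2 (etaS_pos i).ne') hc
  have hη : etaS i ≠ 0 := (etaS_pos i).ne'
  have eM : ∀ c, mulcoS i b (hf c) = coordAlgHom i b (cutMulY (hf c)) := fun c => rfl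
  have eΔ : dacoS i b B cfg parS U₁ = s⁻¹ • coordAlgHom i b (deltaPrimeAY i parS (cfg U₁)) := rfl
  have eP : ∀ c μ, dirDscoS i b B cfg U₁ μ * ptcoS i b B cfg U₁ (hf c) μ = s⁻¹ • coordAlgHom i b (cdsSL i (cfg U₁) μ * ptKY i (cfg U₁) (hf c) μ) := by
    intro c μ
    have e1 : ptcoS i b B cfg U₁ (hf c) μ = (etaS i * cR39 b)⁻¹ • coordAlgHom i b (ptKY i (cfg U₁) (hf c) μ) := rfl
    have e2 : dirDscoS i b B cfg U₁ μ = (etaS i)⁻¹ • coordAlgHom i b (cdsSL i (cfg U₁) μ) := rfl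
    rw [e1, e2, smul_mul_smul_comm, ← map_mul]
    congr 1
    rw [hs]; field_simp
  have eC : ∀ c, ctcoS i b B cfg parS U₁ (hf c) = s⁻¹ • coordAlgHom i b (ctKY i parS (hf c) (cfg U₁)) := fun c => rfl
  have eK : ∀ c, (∑ μ, dirDscoS i b B cfg U₁ μ * ptcoS i b B cfg U₁ (hf c) μ) + ctcoS i b B cfg parS U₁ (hf c)
      = s⁻¹ • coordAlgHom i b ((∑ μ, cdsSL i (cfg U₁) μ * ptKY i (cfg U₁) (hf c) μ) + ctKY i parS (hf c) (cfg U₁)) := by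
    intro c
    simp only [eP, eC, ← Finset.smul_sum, ← smul_add, ← map_sum, ← map_add]
  simp only [eM, eΔ, eK]
  have lhs : ∀ c, coordAlgHom i b (cutMulY (hf c)) * (s • coordAlgHom i b (Gl c)) * coordAlgHom i b (cutMulY (hf c))
      = s • coordAlgHom i b (cutMulY (hf c) * Gl c * cutMulY (hf c)) := by
    intro c; rw [mul_smul_comm, smul_mul_assoc, map_mul, map_mul]
  have rhs : ∀ c, coordAlgHom i b (cutMulY (hf c)) * (s • coordAlgHom i b (Gl c))
      * (s⁻¹ • coordAlgHom i b ((∑ μ, cdsSL i (cfg U₁) μ * ptKY i (cfg U₁) (hf c) μ) + ctKY i parS (hf c) (cfg U₁)))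
      = coordAlgHom i b (cutMulY (hf c) * Gl c * ((∑ μ, cdsSL i (cfg U₁) μ * ptKY i (cfg U₁) (hf c) μ) + ctKY i parS (hf c) (cfg U₁))) := by
    intro c; simp only [mul_smul_comm, smul_mul_assoc, smul_smul, inv_mul_cancel₀ hs0, one_smul, map_mul]
  -- at the 𝔸-level: `h G K(h) = −(h G (Σ∇*Pᵗ + Cᵗ))` (def-Y `KhY_eq_div_left`)
  have hK : ∀ c, cutMulY (hf c) * Gl c * KhY i parS (hf c) (cfg U₁)
      = -(cutMulY (hf c) * Gl c * ((∑ μ, cdsSL i (cfg U₁) μ * ptKY i (cfg U₁) (hf c) μ) + ctKY i parS (hf c) (cfg U₁))) := by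
    intro c; rw [KhY_eq_div_left]
    exact mul_neg (cutMulY (hf c) * Gl c : Module.End ℂ (SiteY i → 𝔸)) _
  have h388T := eq388T_sum (deltaPrimeAY i parS (cfg U₁)) (fun c => cutMulY (hf c)) Gl (fun c => KhY i parS (hf c) (cfg U₁))
    (fun c => deltaPrimeAY_mul_cutMulY i parS (hf c) (cfg U₁)) hlocT (sum_cutMulY_mul_self hf hsq)
  simp only [lhs, rhs, ← Finset.smul_sum, ← map_sum, smul_mul_smul_comm, mul_inv_cancel₀ hs0, one_smul, ← map_mul,
    h388T, hK, Finset.sum_neg_distrib, ← sub_eq_add_neg, map_sub, map_one]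

end Coords

/-! ## §1 The record with a generic cube letter, its direction letters, the generic reading, and the pins -/

section Record

variable {d ℓ : ℕ} {hd : 1 ≤ d + 1} {hL : Odd (ℓ + 1) ∧ 1 < ℓ + 1} {b₀ b₁ : ℝ} {Mstar : ℕ}
variable {𝔸 : Type} [NormedRing 𝔸] [NormedAlgebra ℂ 𝔸] [CompleteSpace 𝔸] [FiniteDimensional ℝ 𝔸] {κ : Type} [Fintype κ] [DecidableEq κ]
variable (x : MemberY d ℓ hd hL b₀ b₁ Mstar) (b : Module.Basis κ ℝ 𝔸) (B : B9.Backgrounds) (cfg : B.Cfg → CfgY 𝔸 x.toKIdx) (parS : SiteParY 𝔸 x.toKIdx)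
variable (bI : FBondY x.toKIdx → IBondY x.toKIdx)

/-- ★★★ **THE rows-18 WALK LETTERS WITH A GENERIC CUBE LETTER** `opsWalkYO x b B cfg parS bI O`: this lineage's record `opsWalkY` (blocks `blkSK (sIK bI)`, supports `SblkY`,
partition `hWalkY`, the nine kernels, `Gp ∕ Δa ∕ D ∕ Dstar ∕ Lap ∕ C-letters` at node00-def-Y's coordinate models) with the slot `Gsq U □ := GcoS … (O □) U` — the coordinate model
`η²c_R·φ(O □ (cfg U))` of a cube letter `O □ : SiteOpY 𝔸` left FREE (print: `G′_□(U)`, the operator of the cube's own sequence `{Ω_n(□)}`).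
[cite: Balaban1985BackgroundPropagators, pp.408–409 (G′_□(U)), (3.87)–(3.90) p.409; Balaban1984PropagatorsII, (2.36)–(2.44) pp.229–230] -/
def opsWalkYO (O : ↥(cubes x.toKIdx.D.toDomains) → SiteOpY 𝔸 x.toKIdx) : Ops (geo9Y x) B (XSK κ x.toKIdx) (XSK κ x.toKIdx) ↥(cubes x.toKIdx.D.toDomains) :=
  { opsWalkY x b B cfg parS bI with Gsq := fun U c => GcoS x.toKIdx b B cfg (O c) U }

variable (O : ↥(cubes x.toKIdx.D.toDomains) → SiteOpY 𝔸 x.toKIdx)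

/-- ★ the direction operators at the generic record (the same `∇_{U,μ} ∕ ∇*_{U,μ}` models as `dirOpsWalkY`). [cite: Balaban1985BackgroundPropagators, (3.3) p.390, (3.8) p.392] -/
def dirOpsWalkYO : DirOps37 (opsWalkYO x b B cfg parS bI O) (Fin (d + 1)) where
  Dd := fun U μ => dirDcoS x.toKIdx b B cfg U μ
  Dsd := fun U μ => dirDscoS x.toKIdx b B cfg U μ

/-- ★ the direction letters at the generic record (the same `P_□,μ ∕ P^L_□,μ ∕ Pᵗ_□,μ` models and kernels as `dirLettersWalkY`).
[cite: Balaban1985BackgroundPropagators, (3.88) p.409, (3.100) p.413; Balaban1984PropagatorsII, (2.39)–(2.40) pp.229–230] -/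
def dirLettersWalkYO : DirLetters37 (opsWalkYO x b B cfg parS bI O) (Fin (d + 1)) where
  P := fun U c μ => pcoS x.toKIdx b B cfg U (hTY x.toKIdx c) μ
  PL := fun U c μ => plcoS x.toKIdx b B cfg U (hTY x.toKIdx c) μ
  Pt := fun U c μ => ptcoS x.toKIdx b B cfg U (hTY x.toKIdx c) μ
  KPd := kPdY x b bI
  KPLd := kPLdY x b bI
  KPtd := kPtdY x b bI

/-- ★ **THE AGREEMENT PREDICATE WITH A GENERIC READING DOMAIN** `near □` (print's «U restricted to Ω₀(□) ⊂ □̃⁵»): bond variables one step around every site of `near □`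
(forward and backward, every direction) and the averaging transporters issuing from `□̃(□)` coincide — `agreeWalkY` is the case `near := nearDomY x`.
[cite: Balaban1985BackgroundPropagators, p.410 L14–15, (3.24) p.394, (3.88) p.409] -/
def agreeWalkYO (near : ↥(cubes x.toKIdx.D.toDomains) → Finset (SiteY x.toKIdx)) (c : ↥(cubes x.toKIdx.D.toDomains)) (U U' : B.Cfg) : Prop :=
  (∀ z ∈ near c, ∀ μ, UboxY x.toKIdx (cfg U) μ z = UboxY x.toKIdx (cfg U') μ z ∧
      UboxY x.toKIdx (cfg U) μ ((shiftY x.toKIdx μ).symm z) = UboxY x.toKIdx (cfg U') μ ((shiftY x.toKIdx μ).symm z)) ∧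
    (∀ z ∈ cubeDomY x c, ∀ w, avgCoeffY x.toKIdx z w ≠ 0 → avgTrY x.toKIdx parS (cfg U) z w = avgTrY x.toKIdx parS (cfg U') z w)

/-- ★ the walk reading with the generic agreement domain (`ev := evSK` as in `rdWalkY`). [cite: Balaban1985BackgroundPropagators, (3.39) + (3.42) p.397, p.410 L14–15] -/
def rdWalkYO (near : ↥(cubes x.toKIdx.D.toDomains) → Finset (SiteY x.toKIdx)) : WalkReading (geo9Y x) B (XSK κ x.toKIdx) ↥(cubes x.toKIdx.D.toDomains) where
  ev := B9CoReadingCoordsS.evSK x.toKIdx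
  Agree := agreeWalkYO x B cfg parS near

omit [DecidableEq κ] in
/-- ★ **THE RECORD OF THIS LINEAGE IS THE INSTANCE `O □ := GsqY … (cubeDomY x □)`** (so every landed fact about `opsWalkY` is a fact about `opsWalkYO` at that letter).
[cite: Balaban1985BackgroundPropagators, (3.87) p.409, bookkeeping] -/
theorem opsWalkYO_GsqY : opsWalkYO x b B cfg parS bI (fun c => GsqY x.toKIdx parS (cubeDomY x c)) = opsWalkY x b B cfg parS bI := rfl

omit [Fintype κ] [FiniteDimensional ℝ 𝔸] in
/-- the reading of this lineage is the instance `near := nearDomY x`. [cite: Balaban1985BackgroundPropagators, p.410 L14–15, bookkeeping] -/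
theorem rdWalkYO_nearDomY : rdWalkYO x B cfg parS (κ := κ) (nearDomY x) = rdWalkY x B cfg parS := rfl

omit [DecidableEq κ] in
/-- the static fields of the generic record (pins `hblkS hblkYS hhS`; `S′ = S`) — those of `opsWalkY`. [cite: Balaban1985BackgroundPropagators, (3.87) p.409, bookkeeping] -/
theorem opsWalkYO_static :
    (opsWalkYO x b B cfg parS bI O).blk = blkSK x.toKIdx (sIK x.toKIdx bI) ∧ (opsWalkYO x b B cfg parS bI O).blkY = blkSK x.toKIdx (sIK x.toKIdx bI) ∧
    (opsWalkYO x b B cfg parS bI O).S = SblkY x bI ∧ (opsWalkYO x b B cfg parS bI O).S' = SblkY x bI ∧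
    (opsWalkYO x b B cfg parS bI O).h = hWalkY x ∧ (opsWalkYO x b B cfg parS bI O).hY = hWalkY x :=
  ⟨rfl, rfl, rfl, rfl, rfl, rfl⟩

omit [DecidableEq κ] in
/-- ★ the `U`-dependent letters of the generic record (pins `hGpS hGsqS hDS hDsS hLapS` + the `C`-letters and the dead `P`-letters): `Gsq U □ = GcoS … (O □) U`, the rest as `opsWalkY`.
[cite: Balaban1985BackgroundPropagators, (3.87)–(3.88) pp.408–409, (3.42) p.397, bookkeeping] -/
theorem opsWalkYO_letters (U : B.Cfg) (c : ↥(cubes x.toKIdx.D.toDomains)) :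
    (opsWalkYO x b B cfg parS bI O).Gp U = GcoS x.toKIdx b B cfg (GpY x.toKIdx parS) U ∧ (opsWalkYO x b B cfg parS bI O).Δa U = dacoS x.toKIdx b B cfg parS U ∧
    (opsWalkYO x b B cfg parS bI O).Gsq U c = GcoS x.toKIdx b B cfg (O c) U ∧ (opsWalkYO x b B cfg parS bI O).D U = DcoS x.toKIdx b B cfg U ∧
    (opsWalkYO x b B cfg parS bI O).Dstar U = DscoS x.toKIdx b B cfg U ∧ (opsWalkYO x b B cfg parS bI O).Lap U = LcoS x.toKIdx b B cfg U ∧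
    (opsWalkYO x b B cfg parS bI O).Cop U c = ccoS x.toKIdx b B cfg parS U (hTY x.toKIdx c) ∧
    (opsWalkYO x b B cfg parS bI O).Ct U c = ctcoS x.toKIdx b B cfg parS U (hTY x.toKIdx c) ∧
    (opsWalkYO x b B cfg parS bI O).CL U c = clcoS x.toKIdx b (hTY x.toKIdx c) ∧
    (opsWalkYO x b B cfg parS bI O).CD U c = cdcoS x.toKIdx b B cfg U (hTY x.toKIdx c) ∧
    (opsWalkYO x b B cfg parS bI O).CLt U c = cltcoS x.toKIdx b B cfg U (hTY x.toKIdx c) ∧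
    (opsWalkYO x b B cfg parS bI O).P U c = 0 ∧ (opsWalkYO x b B cfg parS bI O).PL U c = 0 ∧ (opsWalkYO x b B cfg parS bI O).Pt U c = 0 ∧
    (opsWalkYO x b B cfg parS bI O).PD U c = 0 :=
  ⟨rfl, rfl, rfl, rfl, rfl, rfl, rfl, rfl, rfl, rfl, rfl, rfl, rfl, rfl, rfl⟩

omit [DecidableEq κ] in
/-- the certificate's shape of the cube-letter pin (`hGsqS` in the `∃ r G, Gsq = r • coordOpK b (fun _ => G)` form the rows-18 readers use).
[cite: Balaban1985BackgroundPropagators, (3.42) p.397, (3.87) p.409, bookkeeping] -/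
theorem opsWalkYO_Gsq_eq_smul_coordOpK (U : B.Cfg) (c : ↥(cubes x.toKIdx.D.toDomains)) :
    (opsWalkYO x b B cfg parS bI O).Gsq U c = (etaS x.toKIdx ^ 2 * cR39 b) • coordOpK b (fun _ : Fin (d + 1) => (O c (cfg U)).restrictScalars ℝ) := rfl

omit [DecidableEq κ] in
/-- the direction operators and letters of the generic record (pins `h𝔡d h𝔡s`), as `dirWalkY_letters`. [cite: Balaban1985BackgroundPropagators, (3.8) p.392, (3.88) p.409, bookkeeping] -/
theorem dirWalkYO_letters (U : B.Cfg) (c : ↥(cubes x.toKIdx.D.toDomains)) (μ : Fin (d + 1)) :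
    (dirOpsWalkYO x b B cfg parS bI O).Dd U μ = dirDcoS x.toKIdx b B cfg U μ ∧ (dirOpsWalkYO x b B cfg parS bI O).Dsd U μ = dirDscoS x.toKIdx b B cfg U μ ∧
    (dirLettersWalkYO x b B cfg parS bI O).P U c μ = pcoS x.toKIdx b B cfg U (hTY x.toKIdx c) μ ∧
    (dirLettersWalkYO x b B cfg parS bI O).PL U c μ = plcoS x.toKIdx b B cfg U (hTY x.toKIdx c) μ ∧
    (dirLettersWalkYO x b B cfg parS bI O).Pt U c μ = ptcoS x.toKIdx b B cfg U (hTY x.toKIdx c) μ ∧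
    (dirLettersWalkYO x b B cfg parS bI O).KPd c μ = kPdY x b bI c μ ∧ (dirLettersWalkYO x b B cfg parS bI O).KPLd c μ = kPLdY x b bI c μ ∧
    (dirLettersWalkYO x b B cfg parS bI O).KPtd c μ = kPtdY x b bI c μ :=
  ⟨rfl, rfl, rfl, rfl, rfl, rfl, rfl, rfl⟩

end Record

/-! ## §2 The laws at the generic record: `StaticOK` (letter-free), `Identities₂` (from the local-inverse laws of `O`), `LocalityDir` (from the locality of `O`) -/

section Laws

variable {d ℓ : ℕ} {hd : 1 ≤ d + 1} {hL : Odd (ℓ + 1) ∧ 1 < ℓ + 1} {b₀ b₁ : ℝ} {Mstar : ℕ}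
variable {𝔸 : Type} [NormedRing 𝔸] [NormedAlgebra ℂ 𝔸] [CompleteSpace 𝔸] [FiniteDimensional ℝ 𝔸] {κ : Type} [Fintype κ] [DecidableEq κ]
variable (x : MemberY d ℓ hd hL b₀ b₁ Mstar) (b : Module.Basis κ ℝ 𝔸) (B : B9.Backgrounds) (cfg : B.Cfg → CfgY 𝔸 x.toKIdx) (parS : SiteParY 𝔸 x.toKIdx)
variable (bI : FBondY x.toKIdx → IBondY x.toKIdx) [Fintype (geo9Y x).Site] [DecidableEq (geo9Y x).Site]
variable (O : ↥(cubes x.toKIdx.D.toDomains) → SiteOpY 𝔸 x.toKIdx)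

omit [DecidableEq κ] in
/-- ★★ **`hst` AT THE GENERIC RECORD** — `StaticOK` reads only the letter-free fields, so it is this lineage's `staticOK_opsWalkY` VERBATIM (radius `ρ ≥ 3`, counts `N_c, N′ ≥ walkCntY`,
`C_ℓ ≥ L²`, pins `hβ1 ∕ hlev`, thresholds `walkCntM₀Y ≤ M`, `nbrM₀Y … 3 ≤ M⋆`). [cite: Balaban1985BackgroundPropagators, (3.87)–(3.89) pp.408–409; Balaban1984PropagatorsII, (2.36)–(2.44) pp.229–230, Lemma 2.1 (2.61) p.234] -/
theorem staticOK_opsWalkYO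
    (hβ1 : ∀ f : FBondY x.toKIdx, (B6Geom246MultiLevelTorus.geomT x.D).dist (β x.hN x.D x.hk (bI f)) (B6GlobalChartV1.blkV1 x.hN x.D f) ≤ 1)
    (hlev : ∀ f : FBondY x.toKIdx, lvl x.hN x.D x.hk (bI f) = (B6GlobalChartV1.blkV1 x.hN x.D f).1.1)
    (hMw : walkCntM₀Y d ℓ hd hL b₀ b₁ Mstar ≤ (geo9Y x).M) (hM3 : nbrM₀Y d ℓ hd hL b₀ b₁ 3 ≤ Mstar)
    {ρ Nc N' Cℓ : ℝ} (hρ : 3 ≤ ρ) (hNc : walkCntY d ℓ hd hL b₀ b₁ Mstar ≤ Nc) (hN' : walkCntY d ℓ hd hL b₀ b₁ Mstar ≤ N') (hCℓ : (((ℓ + 1 : ℕ) : ℝ)) ^ 2 ≤ Cℓ) :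
    StaticOK (opsWalkYO x b B cfg parS bI O) ρ Nc N' Cℓ (kappaWalkY x b) :=
  have h := staticOK_opsWalkY x b B cfg parS bI hβ1 hlev hMw hM3 hρ hNc hN' hCℓ
  { tri := h.tri, refl := h.refl, symm := h.symm, dnn := h.dnn, lenpos := h.lenpos, hh := h.hh, hS := h.hS, hhY := h.hhY, hSY := h.hSY, cnt := h.cnt, cnt' := h.cnt',
    comp := h.comp, KP_nonneg := h.KP_nonneg, KP_loc := h.KP_loc, KP_row := h.KP_row, KC_nonneg := h.KC_nonneg, KC_loc := h.KC_loc, KC_row := h.KC_row,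
    KPD_nonneg := h.KPD_nonneg, KPD_loc := h.KPD_loc, KPD_row := h.KPD_row, KCD_nonneg := h.KCD_nonneg, KCD_loc := h.KCD_loc, KCD_row := h.KCD_row,
    KPL_nonneg := h.KPL_nonneg, KPL_loc := h.KPL_loc, KPL_row := h.KPL_row, KCL_nonneg := h.KCL_nonneg, KCL_loc := h.KCL_loc, KCL_row := h.KCL_row,
    KPt_nonneg := h.KPt_nonneg, KPt_loc := h.KPt_loc, KPt_col := h.KPt_col, KCt_nonneg := h.KCt_nonneg, KCt_loc := h.KCt_loc, KCt_col := h.KCt_col,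
    KCLt_nonneg := h.KCLt_nonneg, KCLt_loc := h.KCLt_loc, KCLt_col := h.KCLt_col }

omit [DecidableEq κ] [DecidableEq (geo9Y x).Site] in
/-- ★★★ **`Identities₂` AT THE GENERIC RECORD, FROM THE TWO LOCAL-INVERSE LAWS OF (3.88) AT `O`**: the 21 clauses of `B9Thm37WholeDir.Identities₂` for
`opsWalkYO ∕ dirOpsWalkYO ∕ dirLettersWalkYO` at a configuration `U` whose bond variables and averaging transporters are contraction pairs, under the pins `hβ1 ∕ hlev`, `c_R ≠ 0`,
`IsUnit Δ′_a(U)`, and — HYPOTHESES on the letter — `h_□·Δ′_a(U)·O □ (U)·h_□ = h_□²` (`hloc`) and `h_□·O □ (U)·Δ′_a(U)·h_□ = h_□²` (`hlocT`) for the partition of record `h_□ = hTY □`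
(print's «hence», p. 409; for `GsqY` both are node00-def-Y's `cutMulY_deltaPrimeAY_GsqY_cutMulY`-shape theorems, for `GpCubeY` `Node00/OpsYLocalInverseSeq.localInverse_laws_hTY_GpCubeY`).
[cite: Balaban1985BackgroundPropagators, (3.87)–(3.88) pp.408–409, (3.100) p.413, (3.27) p.395; Balaban1984PropagatorsII, (2.39)–(2.40) pp.229–230, (2.51) p.232] -/
theorem identities₂_opsWalkYO (R : ℝ) (H : Prop)
    (hβ1 : ∀ f : FBondY x.toKIdx, (B6Geom246MultiLevelTorus.geomT x.D).dist (β x.hN x.D x.hk (bI f)) (B6GlobalChartV1.blkV1 x.hN x.D f) ≤ 1)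
    (hlev : ∀ f : FBondY x.toKIdx, lvl x.hN x.D x.hk (bI f) = (B6GlobalChartV1.blkV1 x.hN x.D f).1.1)
    (hc : cR39 b ≠ 0) (U : B.Cfg)
    (hU : ∀ (μ : Fin (d + 1)) (w : SiteY x.toKIdx), ‖(UboxY x.toKIdx (cfg U) μ w : 𝔸)‖ ≤ 1 ∧ ‖(((UboxY x.toKIdx (cfg U) μ w)⁻¹ : 𝔸ˣ) : 𝔸)‖ ≤ 1)
    (hT : ∀ z w : SiteY x.toKIdx, ‖(avgTrY x.toKIdx parS (cfg U) z w : 𝔸)‖ ≤ 1 ∧ ‖(((avgTrY x.toKIdx parS (cfg U) z w)⁻¹ : 𝔸ˣ) : 𝔸)‖ ≤ 1)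
    (hΔ : IsUnit (deltaPrimeAY x.toKIdx parS (cfg U)))
    (hloc : ∀ c : ↥(cubes x.toKIdx.D.toDomains),
      cutMulY (hTY x.toKIdx c) * deltaPrimeAY x.toKIdx parS (cfg U) * O c (cfg U) * cutMulY (hTY x.toKIdx c) = cutMulY (hTY x.toKIdx c) * cutMulY (hTY x.toKIdx c))
    (hlocT : ∀ c : ↥(cubes x.toKIdx.D.toDomains),
      cutMulY (hTY x.toKIdx c) * O c (cfg U) * deltaPrimeAY x.toKIdx parS (cfg U) * cutMulY (hTY x.toKIdx c) = cutMulY (hTY x.toKIdx c) * cutMulY (hTY x.toKIdx c)) :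
    Identities₂ (opsWalkYO x b B cfg parS bI O) (dirOpsWalkYO x b B cfg parS bI O) (dirLettersWalkYO x b B cfg parS bI O) R H U := by
  have hnn := fun c μ a y'' => kernels_nonneg x b bI c μ a y''
  have hsq : ∀ z : SiteY x.toKIdx, ∑ c : ↥(cubes x.toKIdx.D.toDomains), hTY x.toKIdx c z ^ 2 = 1 := fun z =>
    sum_hT_sq x.toKIdx.D (one_le_Mh_and_P x.toKIdx).1 (one_le_Mh_and_P x.toKIdx).2 z
  have hm : ∀ c : ↥(cubes x.toKIdx.D.toDomains), mulOp ((opsWalkYO x b B cfg parS bI O).h c) = mulcoS x.toKIdx b (hTY x.toKIdx c) :=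
    fun c => mulOp_hWalkY_eq_mulcoS x b c
  have hmY : ∀ c : ↥(cubes x.toKIdx.D.toDomains), mulOp ((opsWalkYO x b B cfg parS bI O).hY c) = mulcoS x.toKIdx b (hTY x.toKIdx c) :=
    fun c => mulOp_hWalkY_eq_mulcoS x b c
  have hG : ∀ c : ↥(cubes x.toKIdx.D.toDomains), (opsWalkYO x b B cfg parS bI O).Gsq U c = (etaS x.toKIdx ^ 2 * cR39 b) • coordAlgHom x.toKIdx b (O c (cfg U)) :=
    fun c => rfl
  refine
    { hP := fun c μ => hasMajorant_pcoS_kPdY x b B cfg R H hβ1 c μ U (hU μ)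
      hPL := fun c μ => hasMajorant_plcoS_kPLdY x b B cfg R H hβ1 c μ U (hU μ)
      hPt := fun c μ => hasMajorant_ptcoS_kPtdY x b B cfg R H hβ1 c μ U (hU μ)
      KPd_nonneg := fun c μ a y'' => (hnn c μ a y'').1
      KPLd_nonneg := fun c μ a y'' => (hnn c μ a y'').2.2.2.2.1
      KPtd_nonneg := fun c μ a y'' => (hnn c μ a y'').2.2.1
      KPd_sum := fun c a y'' => le_of_eq (sum_kPdY x b bI c a y'')
      KPLd_sum := fun c a y'' => le_of_eq (sum_kPLdY x b bI c a y'')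
      KPtd_sum := fun c a y'' => le_of_eq (sum_kPtdY x b bI c a y'')
      hC := fun c => hasMajorant_ccoS_kCY x b B cfg parS R H hβ1 hlev c U hT
      hPD := fun c => hasMajorantHom_zero _ _
      hCD := fun c => (hasMajorantHom_iff _ _ _).2 (hasMajorant_cdcoS_kCDY x b B cfg R H hβ1 c U hU)
      hCL := fun c => (hasMajorantHom_iff _ _ _).2 (hasMajorant_clcoS_kCLY x b R H hβ1 c)
      hCt := fun c => hasMajorant_ctcoS_kCtY x b B cfg parS R H hβ1 hlev c U hT
      hCLt := fun c => (hasMajorantHom_iff _ _ _).2 (hasMajorant_cltcoS_kCLtY x b B cfg R H hβ1 c U hU)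
      leibD := fun c => by rw [hm c, hmY c]; exact leibD_coords x.toKIdx b B cfg U (hTY x.toKIdx c)
      leibT := fun c => by rw [hm c, hmY c]; exact leibT_coords x.toKIdx b B cfg U (hTY x.toKIdx c)
      inv := inv_coords x.toKIdx b B cfg parS hc U hΔ
      leibL := fun c => by rw [hm c]; exact leibL_coords x.toKIdx b B cfg U (hTY x.toKIdx c)
      eq388 := ?_
      eq388T := ?_ }
  · have h := eq388_coords_of_loc x.toKIdx b B cfg parS hc U (fun c => hTY x.toKIdx c) hsq (fun c => O c (cfg U)) hloc
    simp only [hm, hG]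
    exact h
  · have h := eq388T_coords_of_locT x.toKIdx b B cfg parS hc U (fun c => hTY x.toKIdx c) hsq (fun c => O c (cfg U)) hlocT
    simp only [hm, hG]
    exact h

omit [DecidableEq κ] [Fintype (geo9Y x).Site] [DecidableEq (geo9Y x).Site] in
/-- ★ **THE `K`-LETTER OF THE GENERIC RECORD IS THE COORDINATE MODEL OF PRINT'S `K(h_□)(U)`** (letter-free; as `kopDir_opsWalkY_eq`).
[cite: Balaban1985BackgroundPropagators, (3.88) p.409; Balaban1984PropagatorsII, (2.39) p.229] -/
theorem kopDir_opsWalkYO_eq (U : B.Cfg) (c : ↥(cubes x.toKIdx.D.toDomains)) :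
    KopDir (opsWalkYO x b B cfg parS bI O) (dirOpsWalkYO x b B cfg parS bI O) (dirLettersWalkYO x b B cfg parS bI O) U c
      = (etaS x.toKIdx ^ 2 * cR39 b)⁻¹ • coordAlgHom x.toKIdx b (KhY x.toKIdx parS (hTY x.toKIdx c) (cfg U)) := by
  show (∑ μ, pcoS x.toKIdx b B cfg U (hTY x.toKIdx c) μ * dirDcoS x.toKIdx b B cfg U μ) + ccoS x.toKIdx b B cfg parS U (hTY x.toKIdx c) = _
  have eP : ∀ μ, pcoS x.toKIdx b B cfg U (hTY x.toKIdx c) μ * dirDcoS x.toKIdx b B cfg U μ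
      = (etaS x.toKIdx ^ 2 * cR39 b)⁻¹ • coordAlgHom x.toKIdx b (pKY x.toKIdx (cfg U) (hTY x.toKIdx c) μ * cdSL x.toKIdx (cfg U) μ) := by
    intro μ
    have e1 : pcoS x.toKIdx b B cfg U (hTY x.toKIdx c) μ = (etaS x.toKIdx * cR39 b)⁻¹ • coordAlgHom x.toKIdx b (pKY x.toKIdx (cfg U) (hTY x.toKIdx c) μ) := rfl
    have e2 : dirDcoS x.toKIdx b B cfg U μ = (etaS x.toKIdx)⁻¹ • coordAlgHom x.toKIdx b (cdSL x.toKIdx (cfg U) μ) := rfl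
    rw [e1, e2, smul_mul_smul_comm, ← map_mul]
    congr 1
    ring
  have eC : ccoS x.toKIdx b B cfg parS U (hTY x.toKIdx c) = (etaS x.toKIdx ^ 2 * cR39 b)⁻¹ • coordAlgHom x.toKIdx b (cKY x.toKIdx parS (hTY x.toKIdx c) (cfg U)) := rfl
  simp only [eP, eC, ← Finset.smul_sum, ← smul_add, ← map_sum, ← map_add, ← KhY_eq_grad_right]

omit [Fintype (geo9Y x).Site] [DecidableEq (geo9Y x).Site] in
/-- ★★★ **`hloc` AT THE GENERIC RECORD**: `LocalityDir (opsWalkYO …) (dirOpsWalkYO …) (dirLettersWalkYO …) (rdWalkYO … near)` from the LOCALITY OF THE CUBE LETTER on the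
reading domain (`hO`: configurations agreeing in the sense of `agreeWalkYO near □` give the same `O □` — print's «G′_□ depends on U restricted to Ω₀(□)», a HYPOTHESIS on the
letter) and `□̃ + 1 ⊆ near □` (`hnear`, so that `K(h_□)`, which reads `U` one step around `□̃(□)`, is covered — print's «K(h) is semi-local», proved: `KhY_apply_congr_of_reads`).
[cite: Balaban1985BackgroundPropagators, Cor. 3.8 p.410 L14–15, (3.87)–(3.88) p.409, (3.24) p.394; Balaban1984PropagatorsII, (2.37)–(2.39) p.229] -/
theorem localityDir_opsWalkYO (near : ↥(cubes x.toKIdx.D.toDomains) → Finset (SiteY x.toKIdx)) (hnear : ∀ c, nearDomY x c ⊆ near c)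
    (hO : ∀ (c : ↥(cubes x.toKIdx.D.toDomains)) (U U' : B.Cfg), agreeWalkYO x B cfg parS near c U U' → O c (cfg U) = O c (cfg U')) :
    LocalityDir (opsWalkYO x b B cfg parS bI O) (dirOpsWalkYO x b B cfg parS bI O) (dirLettersWalkYO x b B cfg parS bI O) (rdWalkYO x B cfg parS near) := by
  have eG : ∀ (V : B.Cfg) (c : ↥(cubes x.toKIdx.D.toDomains)),
      (opsWalkYO x b B cfg parS bI O).Gsq V c = (etaS x.toKIdx ^ 2 * cR39 b) • coordAlgHom x.toKIdx b (O c (cfg V)) := fun V c => rfl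
  have eM : ∀ c : ↥(cubes x.toKIdx.D.toDomains), mulOp ((opsWalkYO x b B cfg parS bI O).h c) = coordAlgHom x.toKIdx b (cutMulY (hTY x.toKIdx c)) :=
    fun c => mulOp_hWalkY_eq_mulcoS x b c
  refine ⟨fun c U U' hA => ?_, fun c U U' hA => ?_⟩
  · have hA' : agreeWalkYO x B cfg parS near c U U' := hA
    rw [eG, eG, hO c U U' hA']
  · have hA' : agreeWalkYO x B cfg parS near c U U' := hA
    -- the 𝔸-level `kgh`: `K(h_□)(U)·O_□(U′)·M_{h_□} = K(h_□)(U′)·O_□(U′)·M_{h_□}` — `K(h_□)` reads `U` one step around `□̃(□) ⊆ near □`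
    have hK : KhY x.toKIdx parS (hTY x.toKIdx c) (cfg U) * O c (cfg U') * cutMulY (hTY x.toKIdx c)
        = KhY x.toKIdx parS (hTY x.toKIdx c) (cfg U') * O c (cfg U') * cutMulY (hTY x.toKIdx c) := by
      refine LinearMap.ext fun Λ => funext fun z => ?_
      simp only [Module.End.mul_apply]
      exact KhY_apply_congr_of_reads x.toKIdx parS (hTY x.toKIdx c) _ z
        (fun μ hμ => (hA'.1 z (hnear c (mem_nearDomY_of_fdiff x c μ hμ)) μ).1)
        (fun μ hμ => (hA'.1 z (hnear c (mem_nearDomY_of_bdiff x c μ hμ)) μ).2)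
        (fun w hw hzw => hA'.2 z (mem_cubeDomY_of_avg x c hw hzw) w hw)
    rw [kopDir_opsWalkYO_eq, kopDir_opsWalkYO_eq, eG, eG, eM, hO c U U' hA']
    simp only [mul_smul_comm, smul_mul_assoc, ← map_mul, hK]

end Laws

end Literature.MathematicalPhysics.QuantumFieldTheory.Balaban1983to89.B9WalkLettersOpsO

end
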